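import Literature.NumberTheory.Automorphic.DilationThickeningGL2
import Literature.NumberTheory.Automorphic.QuaternionAlgebraAdelicFujisaki
import HarnessLib

/-!
# Volumes of the mean-square regions of `GL₂(𝔸_K)` and the Jacobian inequality

Topic `NumberTheory/Automorphic`; namespace `Literature.NumberTheory.Automorphic`. A brick of the
mean-square route to Jacquet–Shalika's Theorem (5.3) for `GL₂`
(`StandardLFunctionData.multipliable_L`; files `DilationThickeningGL2`, `IwasawaHaarGL2`,
`InvariantMeasureDominationExplicit`). For the regions `D = N'' · d(z(r) Y₁', C₂') · K ⊆ GL₂(𝔸_K)`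
(`iwasawaRegionGL2`; `z(r) = posRealIdele K r` the archimedean dilation, `Δ(z(r)) = r^{[K:ℚ]}`
its module) this file proves the two measure-theoretic estimates that make the domination lemma
with its explicit constant effective:

* `coords_of_mul_mem_iwasawaRegionGL2` — **Borel coordinates of the points of a region**: if
  `d(a₁,a₂) u k ∈ D` then `a₁ ∈ A₁ M₁`, `a₂ ∈ A₂ M₂`, `u ∈ (d(a)⁻¹ N'' d(a)) M_N`, where `M₁, M₂, M_N`
  are the Borel coordinates of the compact group `B ∩ K` (`borelCompactPartGL2`; uniqueness of the
  coordinates `B ≅ T × N`, `borelCoordGL2`);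
* `measure_image_torusConjGL2` — `ν(d(a)⁻¹ S d(a)) = Δ(a₁⁻¹ a₂) ν(S)` (from
  `lintegral_comp_torusConjGL2`); `exists_distribHaarChar_le_of_isCompact` — the module is bounded
  on compact sets (`continuous_distribHaarChar`);
* `measure_iwasawaRegionGL2_le` — **volume bound**: for compact data and Haar measures there is
  `C < ∞` with `μ_G(N'' · d(z(r) Y₁', C₂') · K) ≤ C · Δ(z(r))⁻¹` for all `r ≤ 1` (in Iwasawa
  coordinates, `lintegral_eq_iwasawa`, the `u`-slice has measure `Δ(a₁⁻¹ a₂) ν(N'' N₁)` and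
  `Δ(a₁⁻¹ a₂) = Δ(z(r))⁻¹ Δ(y⁻¹ a₂)` is bounded on the compact torus data);
* `lintegral_regionCoords_le` — **Jacobian inequality**:
  `∫_{z(r)Y₁} ∫_{C₂} ∫_S ∫_{K_c} f(u d(a₁,a₂) k) dμ_K dν dμ_I dμ_I ≤ C · Δ(z(r)) · ∫_G f dμ_G` for
  all Borel `f ≥ 0`, `S ⊆ N₂(𝔸_K)`, `K_c ⊆ K` (the coordinate measure in the order `u · d(a) · k` is
  `Δ(a₁/a₂) c⁻¹ dμ_G`, `lintegral_unipotent_torus_eq`).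

Both constants depend only on the compact data and the Haar measures, not on `r`: the volume of
the dilated region grows like `X = Δ(z(r))⁻¹` while the coordinate measure used by the mean-square
method shrinks like `X⁻¹`, which is the cancellation behind the uniform dyadic bound.
Everything is proved; folklore (Haar measure of `GL₂` in Iwasawa coordinates, as in Bump (1997),
§2.1, §3.8; Getz–Hahn (2024), §3.2, §9.5).

## References

* D. Bump, *Automorphic Forms and Representations* (1997), §2.1, §3.8 [Bump1997].
* J. R. Getz, H. Hahn, *An Introduction to Automorphic Representations*, GTM 300 (2024), §3.2, §9.5
  [GetzHahn2024].
-/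

noncomputable section

open MeasureTheory Measure NumberField IsDedekindDomain Matrix Set Filter
open scoped MatrixGroups ENNReal NNReal Pointwise Topology

namespace Literature.NumberTheory.Automorphic

section Volume

variable (K : Type) [Field K] [NumberField K]

/-- `B ∩ K` seen inside the Borel subgroup: a compact subset of `B(𝔸_K)`. [folklore] -/
def borelCompactPartGL2 : Set ↥(standardParabolicGL (AdeleRing (𝓞 K) K) (id : Fin 2 → Fin 2)) :=
  Subtype.val ⁻¹' (standardMaximalCompactGL 2 K : Set (GL (Fin 2) (AdeleRing (𝓞 K) K)))

/-- `B ∩ K` is compact in `B`. [folklore] -/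
theorem isCompact_borelCompactPartGL2 : IsCompact (borelCompactPartGL2 K) := by
  haveI : T2Space (AdeleRing (𝓞 K) K) := t2Space_adeleRing K
  have hBc : IsClosed ((standardParabolicGL (AdeleRing (𝓞 K) K) (id : Fin 2 → Fin 2) :
      Set (GL (Fin 2) (AdeleRing (𝓞 K) K)))) := isClosed_standardParabolicGL_id
  exact hBc.isClosedEmbedding_subtypeVal.isCompact_preimage (isCompact_standardMaximalCompactGL 2 K)

variable {K}

/-- **Borel coordinates of points of a region.** If `d(a₁,a₂) u k` lies in the region
`N'' · d(A₁, A₂) · K`, then `a₁ ∈ A₁ · M₁`, `a₂ ∈ A₂ · M₂` and `u ∈ (d(a)⁻¹ N'' d(a)) · M_N`, where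
`M₁, M₂, M_N` are the Borel coordinates of the compact group `B ∩ K` (uniqueness of the Borel
coordinates `B ≅ T × N`). [folklore] -/
theorem coords_of_mul_mem_iwasawaRegionGL2 {N'' : Set ↥(adelicUnipotent 2 K)} {A₁ A₂ : Set (AdeleRing (𝓞 K) K)ˣ}
    {a₁ a₂ : (AdeleRing (𝓞 K) K)ˣ} {u : ↥(adelicUnipotent 2 K)} {k : GL (Fin 2) (AdeleRing (𝓞 K) K)}
    (hk : k ∈ standardMaximalCompactGL 2 K)
    (h : diagGL2 a₁ a₂ * (u : GL (Fin 2) (AdeleRing (𝓞 K) K)) * k ∈ iwasawaRegionGL2 K N'' A₁ A₂) :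
    a₁ ∈ A₁ * (Prod.fst '' (borelDiagGL2 '' borelCompactPartGL2 K)) ∧
      a₂ ∈ A₂ * (Prod.snd '' (borelDiagGL2 '' borelCompactPartGL2 K)) ∧
      u ∈ torusConjGL2 (a₁, a₂) '' N'' * borelUnipGL2 '' borelCompactPartGL2 K := by
  obtain ⟨s, ⟨nval, ⟨n, hn, rfl⟩, d, ⟨⟨y, c⟩, ⟨hy, hc⟩, rfl⟩, rfl⟩, k', hk', hgeq⟩ := h
  -- `m = k' k⁻¹ = d(y,c)⁻¹ n⁻¹ d(a) u ∈ B ∩ K`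
  set m : GL (Fin 2) (AdeleRing (𝓞 K) K) := k' * k⁻¹ with hm
  have hmK : m ∈ standardMaximalCompactGL 2 K := mul_mem hk' (inv_mem hk)
  have hmeq : m = (diagGL2 y c)⁻¹ * ((n : GL (Fin 2) (AdeleRing (𝓞 K) K)))⁻¹ *
      (diagGL2 a₁ a₂ * (u : GL (Fin 2) (AdeleRing (𝓞 K) K))) := by
    rw [hm]
    have hgeq' : (n : GL (Fin 2) (AdeleRing (𝓞 K) K)) * diagGL2 y c * k' =
        diagGL2 a₁ a₂ * (u : GL (Fin 2) (AdeleRing (𝓞 K) K)) * k := hgeq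
    have : diagGL2 a₁ a₂ * (u : GL (Fin 2) (AdeleRing (𝓞 K) K)) =
        (n : GL (Fin 2) (AdeleRing (𝓞 K) K)) * diagGL2 y c * k' * k⁻¹ := by
      rw [hgeq', mul_inv_cancel_right]
    rw [this]; group
  have hmB : m ∈ standardParabolicGL (AdeleRing (𝓞 K) K) (id : Fin 2 → Fin 2) := by
    rw [hmeq]
    exact mul_mem (mul_mem (inv_mem (diagGL2_mem_standardParabolicGL _ _))
      (inv_mem (upperUnitriangular_le_standardParabolicGL_fin_two n.2)))
      (mul_mem (diagGL2_mem_standardParabolicGL _ _) (upperUnitriangular_le_standardParabolicGL_fin_two u.2))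
  set mB : ↥(standardParabolicGL (AdeleRing (𝓞 K) K) (id : Fin 2 → Fin 2)) := ⟨m, hmB⟩ with hmB'
  have hmM : mB ∈ borelCompactPartGL2 K := hmK
  -- Borel coordinates of `m` and of `d(a) u`
  set μ := borelDiagGL2 mB with hμ
  set mu := borelUnipGL2 mB with hmu
  have hmcoord : m = diagGL2 μ.1 μ.2 * (mu : GL (Fin 2) (AdeleRing (𝓞 K) K)) := (diagGL2_mul_borelUnipGL2 mB).symm
  have hdau : diagGL2 a₁ a₂ * (u : GL (Fin 2) (AdeleRing (𝓞 K) K)) =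
      diagGL2 (y * μ.1) (c * μ.2) * ((torusConjGL2 (y * μ.1, c * μ.2) n * mu : ↥(adelicUnipotent 2 K)) :
        GL (Fin 2) (AdeleRing (𝓞 K) K)) := by
    have h1 : diagGL2 a₁ a₂ * (u : GL (Fin 2) (AdeleRing (𝓞 K) K)) =
        (n : GL (Fin 2) (AdeleRing (𝓞 K) K)) * diagGL2 y c * m := by
      rw [hmeq]; group
    have h2 : diagGL2 (y * μ.1) (c * μ.2) *
        ((torusConjGL2 (y * μ.1, c * μ.2) n : ↥(adelicUnipotent 2 K)) : GL (Fin 2) (AdeleRing (𝓞 K) K)) =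
        (n : GL (Fin 2) (AdeleRing (𝓞 K) K)) * diagGL2 (y * μ.1) (c * μ.2) :=
      diagGL2_mul_torusConjGL2 (y * μ.1, c * μ.2) n
    rw [h1, hmcoord, Subgroup.coe_mul, ← mul_assoc (diagGL2 (y * μ.1) (c * μ.2)), h2, diagGL2_mul]
    group
  have hcoord : (borelCoordGL2 ((a₁, a₂), u) : ↥(standardParabolicGL (AdeleRing (𝓞 K) K) (id : Fin 2 → Fin 2))) =
      borelCoordGL2 ((y * μ.1, c * μ.2), torusConjGL2 (y * μ.1, c * μ.2) n * mu) :=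
    Subtype.ext hdau
  have hinj := borelCoordGL2.injective hcoord
  simp only [Prod.mk.injEq] at hinj
  obtain ⟨⟨rfl, rfl⟩, rfl⟩ := hinj
  refine ⟨Set.mul_mem_mul hy ⟨μ, ⟨mB, hmM, rfl⟩, rfl⟩, Set.mul_mem_mul hc ⟨μ, ⟨mB, hmM, rfl⟩, rfl⟩,
    Set.mul_mem_mul ⟨n, hn, rfl⟩ ⟨mB, hmM, rfl⟩⟩

/-- Images under the torus conjugation are preimages under the inverse conjugation. [folklore] -/
theorem image_torusConjGL2_eq_preimage {R : Type*} [CommRing R] (a : Rˣ × Rˣ) (S : Set ↥(upperUnitriangular (Fin 2) R)) :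
    torusConjGL2 a '' S = torusConjGL2 a⁻¹ ⁻¹' S := by
  ext u
  constructor
  · rintro ⟨v, hv, rfl⟩
    change torusConjGL2 a⁻¹ (torusConjGL2 a v) ∈ S
    rwa [torusConjGL2_inv_apply]
  · intro hu
    refine ⟨torusConjGL2 a⁻¹ u, hu, ?_⟩
    have := torusConjGL2_inv_apply a⁻¹ u
    rwa [inv_inv] at this

variable [MeasurableSpace (GL (Fin 2) (AdeleRing (𝓞 K) K))] [BorelSpace (GL (Fin 2) (AdeleRing (𝓞 K) K))]
  [MeasurableSpace (AdeleRing (𝓞 K) K)ˣ] [BorelSpace (AdeleRing (𝓞 K) K)ˣ]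
  [MeasurableSpace (AdeleRing (𝓞 K) K)] [BorelSpace (AdeleRing (𝓞 K) K)]
  [LocallyCompactSpace (AdeleRing (𝓞 K) K)]

omit [MeasurableSpace (AdeleRing (𝓞 K) K)ˣ] [BorelSpace (AdeleRing (𝓞 K) K)ˣ] in
/-- **The measure of a torus conjugate**: `ν(d(a)⁻¹ S d(a)) = Δ(a₁⁻¹ a₂) ν(S)`. [folklore] -/
theorem measure_image_torusConjGL2 (ν : Measure ↥(adelicUnipotent 2 K)) [IsHaarMeasure ν]
    (a : (AdeleRing (𝓞 K) K)ˣ × (AdeleRing (𝓞 K) K)ˣ) {S : Set ↥(adelicUnipotent 2 K)} (hS : MeasurableSet S) :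
    ν (torusConjGL2 a '' S) = ((distribHaarChar (AdeleRing (𝓞 K) K) (a.1⁻¹ * a.2) : ℝ≥0) : ℝ≥0∞) * ν S := by
  have hmeas : Measurable (fun u : ↥(adelicUnipotent 2 K) => torusConjGL2 a⁻¹ u) :=
    (continuous_torusConjGL2.comp (continuous_const.prodMk continuous_id)).measurable
  rw [image_torusConjGL2_eq_preimage]
  calc ν (torusConjGL2 a⁻¹ ⁻¹' S) = ∫⁻ u, S.indicator 1 (torusConjGL2 a⁻¹ u) ∂ν := by
        rw [← lintegral_indicator_one (hmeas hS)]; rfl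
    _ = ((distribHaarChar (AdeleRing (𝓞 K) K) ((a⁻¹).1 * ((a⁻¹).2)⁻¹) : ℝ≥0) : ℝ≥0∞) * ∫⁻ u, S.indicator 1 u ∂ν :=
        lintegral_comp_torusConjGL2 K ν a⁻¹ (measurable_one.indicator hS)
    _ = ((distribHaarChar (AdeleRing (𝓞 K) K) (a.1⁻¹ * a.2) : ℝ≥0) : ℝ≥0∞) * ν S := by
        rw [lintegral_indicator_one hS, Prod.fst_inv, Prod.snd_inv, inv_inv]

omit [MeasurableSpace (GL (Fin 2) (AdeleRing (𝓞 K) K))] [BorelSpace (GL (Fin 2) (AdeleRing (𝓞 K) K))]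
  [MeasurableSpace (AdeleRing (𝓞 K) K)ˣ] [BorelSpace (AdeleRing (𝓞 K) K)ˣ] in
/-- The module is bounded on compact sets of ideles (it is continuous, `continuous_distribHaarChar`).
[folklore] -/
theorem exists_distribHaarChar_le_of_isCompact {Q : Set (AdeleRing (𝓞 K) K)ˣ} (hQ : IsCompact Q) :
    ∃ C : ℝ≥0, ∀ q ∈ Q, distribHaarChar (AdeleRing (𝓞 K) K) q ≤ C := by
  have hc : Continuous fun g : (AdeleRing (𝓞 K) K)ˣ => distribHaarChar (AdeleRing (𝓞 K) K) g :=
    continuous_distribHaarChar _ _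
  obtain ⟨C, hC⟩ := (hQ.image hc).isBounded.bddAbove
  exact ⟨C, fun q hq => hC ⟨q, hq, rfl⟩⟩

/-- **Volumes of the dilated regions grow at most like the inverse module of the dilation.** For
compact `N'' ⊆ N₂(𝔸_K)`, `Y₁', C₂' ⊆ 𝔸_Kˣ` and Haar measures there is `C < ∞` with
`μ_G(N'' · d(z(r) Y₁', C₂') · K) ≤ C · Δ(z(r))⁻¹` for all `r ≤ 1`: in Iwasawa coordinates
(`lintegral_eq_iwasawa`) a point `d(a) u k` of the region has `a₁ ∈ z(r) Y₁' M₁`, `a₂ ∈ C₂' M₂` and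
`u ∈ (d(a)⁻¹ N'' d(a)) M_N ⊆ d(a)⁻¹ (N'' N₁) d(a)` (`coords_of_mul_mem_iwasawaRegionGL2`,
`exists_compact_torusConj_mem`), whose `ν`-measure is `Δ(a₁⁻¹ a₂) ν(N'' N₁) ≤ Δ(z(r))⁻¹ C_Δ ν(N'' N₁)`.
[folklore] -/
theorem measure_iwasawaRegionGL2_le (μG : Measure (GL (Fin 2) (AdeleRing (𝓞 K) K))) [IsHaarMeasure μG]
    (μI : Measure (AdeleRing (𝓞 K) K)ˣ) [IsHaarMeasure μI] (ν : Measure ↥(adelicUnipotent 2 K)) [IsHaarMeasure ν]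
    (μK : Measure ↥(standardMaximalCompactGL 2 K)) [IsHaarMeasure μK]
    {N'' : Set ↥(adelicUnipotent 2 K)} (hN'' : IsCompact N'') {Y₁' C₂' : Set (AdeleRing (𝓞 K) K)ˣ}
    (hY : IsCompact Y₁') (hC : IsCompact C₂') :
    ∃ C : ℝ≥0∞, C ≠ ⊤ ∧ ∀ r : ℝ≥0ˣ, (r : ℝ≥0) ≤ 1 →
      μG (iwasawaRegionGL2 K N'' (posRealIdele K r • Y₁') C₂') ≤
        C * (((distribHaarChar (AdeleRing (𝓞 K) K) (posRealIdele K r) : ℝ≥0) : ℝ≥0∞))⁻¹ := by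
  obtain ⟨hT2, hLC, hSC⟩ := topology_gl2_adele K
  haveI : T2Space (AdeleRing (𝓞 K) K) := t2Space_adeleRing K
  haveI := locallyCompactSpace_ideleGroup K
  haveI := secondCountableTopology_ideleGroup K
  haveI := t2Space_ideleGroup K
  haveI : CompactSpace ↥(standardMaximalCompactGL 2 K) :=
    isCompact_iff_compactSpace.1 (isCompact_standardMaximalCompactGL 2 K)
  haveI : IsFiniteMeasure μK := CompactSpace.isFiniteMeasure
  -- the Borel coordinates of `B ∩ K`
  set Msub := borelCompactPartGL2 K with hMsub
  have hMc : IsCompact Msub := isCompact_borelCompactPartGL2 K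
  set M₁ : Set (AdeleRing (𝓞 K) K)ˣ := Prod.fst '' (borelDiagGL2 '' Msub) with hM₁
  set M₂ : Set (AdeleRing (𝓞 K) K)ˣ := Prod.snd '' (borelDiagGL2 '' Msub) with hM₂
  set MN : Set ↥(adelicUnipotent 2 K) := borelUnipGL2 '' Msub with hMN
  have hM₁c : IsCompact M₁ := (hMc.image continuous_borelDiagGL2).image continuous_fst
  have hM₂c : IsCompact M₂ := (hMc.image continuous_borelDiagGL2).image continuous_snd
  have hMNc : IsCompact MN := hMc.image continuous_borelUnipGL2
  -- the compact set of torus conjugates of `M_N`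
  obtain ⟨N₁, hN₁c, hN₁⟩ := exists_compact_torusConj_mem ((hY.mul hM₁c).prod (hC.mul hM₂c)) hMNc
  -- a bound for the module on the relevant compact set
  obtain ⟨CΔ, hCΔ⟩ := exists_distribHaarChar_le_of_isCompact (K := K)
    (((hY.mul hM₁c).inv.prod (hC.mul hM₂c)).image (continuous_fst.mul continuous_snd))
  -- the constant
  set c : ℝ≥0∞ := (iwasawaConstGL2 K μI ν μG μK : ℝ≥0∞) with hc
  refine ⟨c * (μI (Y₁' * M₁) * (μI (C₂' * M₂) * ((CΔ : ℝ≥0∞) * ν (N'' * N₁) * μK univ))), ?_, fun r hr => ?_⟩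
  · refine ENNReal.mul_ne_top ENNReal.coe_ne_top (ENNReal.mul_ne_top (hY.mul hM₁c).measure_lt_top.ne
      (ENNReal.mul_ne_top (hC.mul hM₂c).measure_lt_top.ne (ENNReal.mul_ne_top
        (ENNReal.mul_ne_top ENNReal.coe_ne_top (hN''.mul hN₁c).measure_lt_top.ne) (measure_ne_top μK _))))
  set ρ : (AdeleRing (𝓞 K) K)ˣ := posRealIdele K r with hρ
  set E := iwasawaRegionGL2 K N'' (ρ • Y₁') C₂' with hE
  have hEm : MeasurableSet E := (isCompact_iwasawaRegionGL2 hN'' (hY.smul ρ) hC).isClosed.measurableSet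
  set A₁ : Set (AdeleRing (𝓞 K) K)ˣ := ρ • (Y₁' * M₁) with hA₁
  set A₂ : Set (AdeleRing (𝓞 K) K)ˣ := C₂' * M₂ with hA₂
  have hA₁m : MeasurableSet A₁ := ((hY.mul hM₁c).smul ρ).isClosed.measurableSet
  have hA₂m : MeasurableSet A₂ := (hC.mul hM₂c).isClosed.measurableSet
  set D : ℝ≥0∞ := (((distribHaarChar (AdeleRing (𝓞 K) K) ρ : ℝ≥0) : ℝ≥0∞))⁻¹ * ((CΔ : ℝ≥0∞) * ν (N'' * N₁) * μK univ)
    with hD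
  -- Iwasawa coordinates
  rw [← lintegral_indicator_one hEm, lintegral_eq_iwasawa K μI ν μG μK (measurable_one.indicator hEm)]
  -- the pointwise bound on the inner integrals
  have hinner : ∀ a₁ a₂ : (AdeleRing (𝓞 K) K)ˣ,
      ∫⁻ u, ∫⁻ k, E.indicator 1 (diagGL2 a₁ a₂ * (u : GL (Fin 2) (AdeleRing (𝓞 K) K)) * (k : GL (Fin 2) (AdeleRing (𝓞 K) K))) ∂μK ∂ν ≤
        A₁.indicator 1 a₁ * (A₂.indicator 1 a₂ * D) := by
    intro a₁ a₂
    by_cases ha : a₁ ∈ A₁ ∧ a₂ ∈ A₂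
    · -- `u` ranges in `torusConj a '' N'' * M_N ⊆ torusConj a '' (N'' * N₁)`
      obtain ⟨ha₁, ha₂⟩ := ha
      rw [indicator_of_mem ha₁, indicator_of_mem ha₂, Pi.one_apply, Pi.one_apply, one_mul, one_mul]
      have hsub : ∀ u : ↥(adelicUnipotent 2 K), ∀ k : ↥(standardMaximalCompactGL 2 K),
          E.indicator (1 : GL (Fin 2) (AdeleRing (𝓞 K) K) → ℝ≥0∞)
            (diagGL2 a₁ a₂ * (u : GL (Fin 2) (AdeleRing (𝓞 K) K)) * (k : GL (Fin 2) (AdeleRing (𝓞 K) K))) ≤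
            (torusConjGL2 (a₁, a₂) '' (N'' * N₁)).indicator 1 u := by
        intro u k
        by_cases hu : diagGL2 a₁ a₂ * (u : GL (Fin 2) (AdeleRing (𝓞 K) K)) * (k : GL (Fin 2) (AdeleRing (𝓞 K) K)) ∈ E
        · obtain ⟨-, -, hu'⟩ := coords_of_mul_mem_iwasawaRegionGL2 k.2 hu
          obtain ⟨v, ⟨n, hn, rfl⟩, m, hm, hvm⟩ := Set.mem_mul.1 hu'
          have humem : u ∈ torusConjGL2 (a₁, a₂) '' (N'' * N₁) := by
            -- `m = torusConj a (torusConj a⁻¹ m)` with `torusConj a⁻¹ m ∈ N₁`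
            obtain ⟨y₀, hy₀, rfl⟩ := mem_smul_set.1 ha₁
            have hmN₁ : torusConjGL2 (ρ * y₀, a₂)⁻¹ m ∈ N₁ :=
              hN₁ r hr (y₀, a₂) (mk_mem_prod hy₀ ha₂) m hm
            refine ⟨n * torusConjGL2 (ρ • y₀, a₂)⁻¹ m, Set.mul_mem_mul hn hmN₁, ?_⟩
            rw [torusConjGL2_mul, ← hvm]
            congr 1
            have := torusConjGL2_inv_apply (ρ • y₀, a₂)⁻¹ m
            rwa [inv_inv] at this
          rw [indicator_of_mem humem, indicator_of_mem hu, Pi.one_apply, Pi.one_apply]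
        · rw [indicator_of_notMem hu]; exact bot_le
      have hmeasS : MeasurableSet (torusConjGL2 (a₁, a₂) '' (N'' * N₁)) :=
        ((hN''.mul hN₁c).image (continuous_torusConjGL2.comp (continuous_const.prodMk continuous_id))).isClosed.measurableSet
      calc ∫⁻ u, ∫⁻ k, E.indicator 1 (diagGL2 a₁ a₂ * (u : GL (Fin 2) (AdeleRing (𝓞 K) K)) * (k : GL (Fin 2) (AdeleRing (𝓞 K) K))) ∂μK ∂ν
          ≤ ∫⁻ u, ∫⁻ _k, (torusConjGL2 (a₁, a₂) '' (N'' * N₁)).indicator 1 u ∂μK ∂ν :=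
            lintegral_mono fun u => lintegral_mono fun k => hsub u k
        _ = ν (torusConjGL2 (a₁, a₂) '' (N'' * N₁)) * μK univ := by
            simp_rw [lintegral_const]
            rw [lintegral_mul_const _ (measurable_one.indicator hmeasS), lintegral_indicator_one hmeasS]
        _ = ((distribHaarChar (AdeleRing (𝓞 K) K) (a₁⁻¹ * a₂) : ℝ≥0) : ℝ≥0∞) * ν (N'' * N₁) * μK univ := by
            rw [measure_image_torusConjGL2 ν (a₁, a₂) (hN''.mul hN₁c).isClosed.measurableSet]
        _ ≤ D := by
            rw [hD, ← mul_assoc, ← mul_assoc]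
            gcongr
            -- `Δ(a₁⁻¹ a₂) = Δ(ρ)⁻¹ Δ((ρ⁻¹ a₁)⁻¹ a₂) ≤ Δ(ρ)⁻¹ C_Δ`
            obtain ⟨y₀, hy₀, rfl⟩ := mem_smul_set.1 ha₁
            have hq : (ρ • y₀)⁻¹ * a₂ = ρ⁻¹ * (y₀⁻¹ * a₂) := by
              rw [smul_eq_mul, _root_.mul_inv_rev, mul_comm y₀⁻¹ ρ⁻¹, mul_assoc]
            rw [hq, map_mul, map_inv, ENNReal.coe_mul, ENNReal.coe_inv (distribHaarChar_pos).ne']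
            gcongr
            exact hCΔ _ ⟨(y₀⁻¹, a₂), mk_mem_prod (Set.inv_mem_inv.2 hy₀) ha₂, rfl⟩
    · have h0 : ∀ u : ↥(adelicUnipotent 2 K), ∀ k : ↥(standardMaximalCompactGL 2 K),
          E.indicator (1 : GL (Fin 2) (AdeleRing (𝓞 K) K) → ℝ≥0∞)
            (diagGL2 a₁ a₂ * (u : GL (Fin 2) (AdeleRing (𝓞 K) K)) * (k : GL (Fin 2) (AdeleRing (𝓞 K) K))) = 0 := by
        intro u k
        rw [indicator_of_notMem]
        intro hu
        obtain ⟨h1, h2, -⟩ := coords_of_mul_mem_iwasawaRegionGL2 k.2 hu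
        refine ha ⟨?_, h2⟩
        -- `a₁ ∈ (ρ • Y₁') * M₁ = ρ • (Y₁' * M₁)`
        obtain ⟨y', hy', m₁, hm₁, rfl⟩ := Set.mem_mul.1 h1
        obtain ⟨y₀, hy₀, rfl⟩ := mem_smul_set.1 hy'
        refine mem_smul_set.2 ⟨y₀ * m₁, Set.mul_mem_mul hy₀ hm₁, ?_⟩
        rw [smul_eq_mul, smul_eq_mul, mul_assoc]
      calc ∫⁻ u, ∫⁻ k, E.indicator 1 (diagGL2 a₁ a₂ * (u : GL (Fin 2) (AdeleRing (𝓞 K) K)) * (k : GL (Fin 2) (AdeleRing (𝓞 K) K))) ∂μK ∂ν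
          = 0 := by simp only [h0, lintegral_const, zero_mul]
        _ ≤ _ := bot_le
  -- integrate the bound
  calc c * ∫⁻ a₁, ∫⁻ a₂, ∫⁻ u, ∫⁻ k, E.indicator 1
          (diagGL2 a₁ a₂ * (u : GL (Fin 2) (AdeleRing (𝓞 K) K)) * (k : GL (Fin 2) (AdeleRing (𝓞 K) K))) ∂μK ∂ν ∂μI ∂μI
      ≤ c * ∫⁻ a₁, ∫⁻ a₂, A₁.indicator 1 a₁ * (A₂.indicator 1 a₂ * D) ∂μI ∂μI := by
        gcongr with a₁ a₂
        exact hinner a₁ a₂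
    _ = c * (μI A₁ * (μI A₂ * D)) := by
        congr 1
        have h2 : ∀ a₁, ∫⁻ a₂, A₁.indicator (1 : (AdeleRing (𝓞 K) K)ˣ → ℝ≥0∞) a₁ * (A₂.indicator 1 a₂ * D) ∂μI =
            A₁.indicator 1 a₁ * (μI A₂ * D) := by
          intro a₁
          rw [lintegral_const_mul _ ((measurable_one.indicator hA₂m).mul_const _), lintegral_mul_const _
            (measurable_one.indicator hA₂m), lintegral_indicator_one hA₂m]
        simp_rw [h2]
        rw [lintegral_mul_const _ (measurable_one.indicator hA₁m), lintegral_indicator_one hA₁m]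
    _ = c * (μI (Y₁' * M₁) * (μI (C₂' * M₂) * ((CΔ : ℝ≥0∞) * ν (N'' * N₁) * μK univ))) *
          (((distribHaarChar (AdeleRing (𝓞 K) K) ρ : ℝ≥0) : ℝ≥0∞))⁻¹ := by
        rw [hA₁, measure_smul, hD]
        ring

/-! ### The Jacobian inequality for the coordinate integrals -/

/-- **The Jacobian inequality.** For compact `Y₁, C₂ ⊆ 𝔸_Kˣ` there is `C < ∞` such that for all
`r`, all `S ⊆ N₂(𝔸_K)`, `K_c ⊆ K` and all Borel `f ≥ 0` on `GL₂(𝔸_K)`,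
`∫_{z(r)Y₁} ∫_{C₂} ∫_S ∫_{K_c} f(u d(a₁,a₂) k) dμ_K dν dμ_I dμ_I ≤ C · Δ(z(r)) · ∫_G f dμ_G`:
the coordinate measure `dν(u) dμ_I(a₁) dμ_I(a₂) dμ_K(k)` in the order `u · d(a) · k` is
`Δ(a₁/a₂) · c⁻¹ · dμ_G` (`lintegral_unipotent_torus_eq`, `lintegral_eq_iwasawa`), and
`Δ(a₁/a₂) = Δ(z(r)) Δ(y/a₂) ≤ Δ(z(r)) C_J` on `z(r) Y₁ × C₂`. [folklore] -/
theorem lintegral_regionCoords_le (μG : Measure (GL (Fin 2) (AdeleRing (𝓞 K) K))) [IsHaarMeasure μG]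
    (μI : Measure (AdeleRing (𝓞 K) K)ˣ) [IsHaarMeasure μI] (ν : Measure ↥(adelicUnipotent 2 K)) [IsHaarMeasure ν]
    (μK : Measure ↥(standardMaximalCompactGL 2 K)) [IsHaarMeasure μK]
    {Y₁ C₂ : Set (AdeleRing (𝓞 K) K)ˣ} (hY₁ : IsCompact Y₁) (hC₂ : IsCompact C₂) :
    ∃ C : ℝ≥0∞, C ≠ ⊤ ∧ ∀ (r : ℝ≥0ˣ) (S : Set ↥(adelicUnipotent 2 K)) (Kc : Set ↥(standardMaximalCompactGL 2 K))
      {f : GL (Fin 2) (AdeleRing (𝓞 K) K) → ℝ≥0∞}, Measurable f →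
        ∫⁻ a₁ in posRealIdele K r • Y₁, ∫⁻ a₂ in C₂, ∫⁻ u in S, ∫⁻ k in Kc,
            f ((u : GL (Fin 2) (AdeleRing (𝓞 K) K)) * diagGL2 a₁ a₂ * (k : GL (Fin 2) (AdeleRing (𝓞 K) K))) ∂μK ∂ν ∂μI ∂μI ≤
          C * ((distribHaarChar (AdeleRing (𝓞 K) K) (posRealIdele K r) : ℝ≥0) : ℝ≥0∞) * ∫⁻ g, f g ∂μG := by
  obtain ⟨hT2, hLC, hSC⟩ := topology_gl2_adele K
  haveI : T2Space (AdeleRing (𝓞 K) K) := t2Space_adeleRing K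
  haveI := locallyCompactSpace_ideleGroup K
  haveI := secondCountableTopology_ideleGroup K
  haveI := t2Space_ideleGroup K
  haveI : CompactSpace ↥(standardMaximalCompactGL 2 K) :=
    isCompact_iff_compactSpace.1 (isCompact_standardMaximalCompactGL 2 K)
  haveI : IsFiniteMeasure μK := CompactSpace.isFiniteMeasure
  obtain ⟨CJ, hCJ⟩ := exists_distribHaarChar_le_of_isCompact (K := K)
    ((hY₁.prod hC₂.inv).image (continuous_fst.mul continuous_snd))
  set c : ℝ≥0∞ := (iwasawaConstGL2 K μI ν μG μK : ℝ≥0∞) with hc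
  have hc0 : c ≠ 0 := by
    rw [hc, Ne, ENNReal.coe_eq_zero]
    exact (iwasawaConstGL2_pos K μI ν μG μK).ne'
  have hctop : c ≠ ⊤ := ENNReal.coe_ne_top
  refine ⟨(CJ : ℝ≥0∞) * c⁻¹, ENNReal.mul_ne_top ENNReal.coe_ne_top (ENNReal.inv_ne_top.2 hc0), fun r S Kc f hf => ?_⟩
  set ρ : (AdeleRing (𝓞 K) K)ˣ := posRealIdele K r with hρ
  set Δρ : ℝ≥0∞ := ((distribHaarChar (AdeleRing (𝓞 K) K) ρ : ℝ≥0) : ℝ≥0∞) with hΔρ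
  set G : (AdeleRing (𝓞 K) K)ˣ → (AdeleRing (𝓞 K) K)ˣ → ℝ≥0∞ := fun a₁ a₂ =>
    ∫⁻ u, ∫⁻ k, f (diagGL2 a₁ a₂ * (u : GL (Fin 2) (AdeleRing (𝓞 K) K)) * (k : GL (Fin 2) (AdeleRing (𝓞 K) K))) ∂μK ∂ν with hG
  have hρm : MeasurableSet (ρ • Y₁) := (hY₁.smul ρ).isClosed.measurableSet
  have hC₂m : MeasurableSet C₂ := hC₂.isClosed.measurableSet
  -- the pointwise Jacobian bound
  have hpt : ∀ a₁ ∈ ρ • Y₁, ∀ a₂ ∈ C₂,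
      ∫⁻ u in S, ∫⁻ k in Kc, f ((u : GL (Fin 2) (AdeleRing (𝓞 K) K)) * diagGL2 a₁ a₂ * (k : GL (Fin 2) (AdeleRing (𝓞 K) K))) ∂μK ∂ν ≤
        Δρ * CJ * G a₁ a₂ := by
    intro a₁ ha₁ a₂ ha₂
    obtain ⟨y, hy, rfl⟩ := mem_smul_set.1 ha₁
    calc ∫⁻ u in S, ∫⁻ k in Kc, f ((u : GL (Fin 2) (AdeleRing (𝓞 K) K)) * diagGL2 (ρ • y) a₂ * (k : GL (Fin 2) (AdeleRing (𝓞 K) K))) ∂μK ∂ν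
        ≤ ∫⁻ u, ∫⁻ k, f ((u : GL (Fin 2) (AdeleRing (𝓞 K) K)) * diagGL2 (ρ • y) a₂ * (k : GL (Fin 2) (AdeleRing (𝓞 K) K))) ∂μK ∂ν :=
          (setLIntegral_le_lintegral S _).trans (lintegral_mono fun u => setLIntegral_le_lintegral Kc _)
      _ = ((distribHaarChar (AdeleRing (𝓞 K) K) ((ρ • y) * a₂⁻¹) : ℝ≥0) : ℝ≥0∞) * G (ρ • y) a₂ :=
          lintegral_unipotent_torus_eq K ν μK (ρ • y, a₂) hf
      _ ≤ Δρ * CJ * G (ρ • y) a₂ := by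
          gcongr
          rw [smul_eq_mul, mul_assoc, map_mul, ENNReal.coe_mul]
          gcongr
          exact hCJ _ ⟨(y, a₂⁻¹), mk_mem_prod hy (Set.inv_mem_inv.2 ha₂), rfl⟩
  -- the Iwasawa formula for the remaining integrals
  have hiw : ∫⁻ a₁, ∫⁻ a₂, G a₁ a₂ ∂μI ∂μI = c⁻¹ * ∫⁻ g, f g ∂μG := by
    rw [lintegral_eq_iwasawa K μI ν μG μK hf, ← hc, ENNReal.inv_mul_cancel_left hc0 hctop]
  have hfin : Δρ * CJ ≠ ⊤ := ENNReal.mul_ne_top ENNReal.coe_ne_top ENNReal.coe_ne_top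
  calc ∫⁻ a₁ in ρ • Y₁, ∫⁻ a₂ in C₂, ∫⁻ u in S, ∫⁻ k in Kc,
          f ((u : GL (Fin 2) (AdeleRing (𝓞 K) K)) * diagGL2 a₁ a₂ * (k : GL (Fin 2) (AdeleRing (𝓞 K) K))) ∂μK ∂ν ∂μI ∂μI
      ≤ ∫⁻ a₁ in ρ • Y₁, ∫⁻ a₂ in C₂, Δρ * CJ * G a₁ a₂ ∂μI ∂μI :=
        setLIntegral_mono' hρm fun a₁ ha₁ => setLIntegral_mono' hC₂m fun a₂ ha₂ => hpt a₁ ha₁ a₂ ha₂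
    _ ≤ ∫⁻ a₁, ∫⁻ a₂, Δρ * CJ * G a₁ a₂ ∂μI ∂μI :=
        (setLIntegral_le_lintegral _ _).trans (lintegral_mono fun a₁ => setLIntegral_le_lintegral _ _)
    _ = Δρ * CJ * (c⁻¹ * ∫⁻ g, f g ∂μG) := by
        rw [← hiw, ← lintegral_const_mul' _ _ hfin]
        congr 1
        funext a₁
        rw [lintegral_const_mul' _ _ hfin]
    _ = (CJ : ℝ≥0∞) * c⁻¹ * Δρ * ∫⁻ g, f g ∂μG := by ring

end Volume

end Literature.NumberTheory.Automorphic
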